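import Literature.AlgebraicGeometry.Motives.ReducedClosedSubschemeIso
import Literature.AlgebraicGeometry.Motives.VarietiesProperProofs
import Literature.AlgebraicGeometry.Resolution.ComponentGluing
import Literature.AlgebraicGeometry.Resolution.BlowupRegularPoints
import Summits.ResolutionOfSingularities.ResolutionOfSingularities.Theorems.HilbertSamuelEliminationSigmaMaxModificationsCorridor3WLadderIsoTailsBaseChangeFibre
import HarnessLib

/-!
# [OURS · L1 W4.5(b) · EL♮(3)] DEAL «ND-K5», brick (B4γ) `ndInv_init` — SUPPORT: the `range ι`-vs-`H` plumbing
# (`…NatNDRangeSubscheme`; WIDTH TABLE D1 row nose-w1, lead-2 mapping (3), desk collision ruling 2026-08-28T14:45:53Z)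

Cell `res-hironaka`, crux EL♮(3) `EquisingularLiftNatThree` (stmt-ResolutionOfSingularities-20148), chain W4.5b, line `sections`.
res-L1-w45b-nose-w1 g0 (WIDTH seat; support under res-type-027 g19, who owns the brick (B4γ) `ND.ndInv_init` of SPEC
`Cruxes/EquisingularLiftNatThree/NewtonNondegenerateRungK5.lean` §13.10).  OURS; NOT a statement of any manuscript; nothing of
[Hironaka2017] is asserted; AI-written kernel plumbing, weaker than expert review.  Def-free, `sorry`-free, standard axioms.
`--kind proof --supports stmt-ResolutionOfSingularities-20148 --as helper`.

The downstairs invariant `ND.NDInv n k m F ρ T` (tree `…NatNDInvariants`, p639684) speaks about the REDUCED CLOSED SUBSCHEME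
`T̂ := (vanishingIdeal ⟨closure T, _⟩).subscheme` of the ambient floor, while the crux hypotheses (`IsIntegral H`, `hfin : Set.Finite
{x : H | ¬ IsRegularLocalRing (H.presheaf.stalk x)}`) speak about the abstract scheme `H` with its closed immersion `ι : H ⟶ ℙⁿ_k`.
At the initial stage `T = Set.range ι`, so (B4γ) needs the dictionary between the two.  This file provides it:

* `vanishingIdeal_closure_range_eq_ker` — for a closed immersion `ι` from a REDUCED scheme, `𝓘(closure (range ι)) = ι.ker`
  (the tree's reduced-induced-structure lemma `Literature…Motives.ker_eq_vanishingIdeal_of_isReduced`, Hartshorne II Ex. 3.2.6);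
* `exists_iso_subscheme_vanishingIdeal_closure_range` — an isomorphism `e : H ≅ T̂` over the ambient scheme (`e.hom ≫ T̂.ι = ι`);
* `isRegularLocalRing_stalk_iff_of_iso_over` — stalk regularity is transported along such an `e`;
* `isClosed_singleton_of_not_isRegularLocalRing` — on a scheme locally of finite type over a perfect field whose non-regular locus is
  finite, every non-regular point is closed (regular locus open: tree `isOpen_regularLocus_of_locallyOfFiniteType_perfectField`; a point
  of a finite closed set of a Jacobson space is closed: tree `…IsoTailsHS.isClosed_singleton_of_mem_finite_closed`);
* `exists_finset_nonregular_range` — THE `S`-BLOCK OF `ND.NDInv` at the initial stage, for `ι : H ⟶ ℙⁿ_k` a closed immersion, `H`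
  reduced, `k` algebraically closed, `hfin` as in the crux: a `Finset` `S` of `ℙⁿ_k` with
  `∀ z : T̂, IsRegularLocalRing (𝒪_{T̂,z}) ↔ T̂.ι z ∉ S` and, for every `x ∈ S`: `x ∈ range T̂.ι`, `IsClosed {x}`, and `x = ι x₀` for a
  NON-REGULAR point `x₀` of `H` (the consumer adds the ND frame at `x` from `IsoHypNDWon`).

References (mathematics): R. Hartshorne, *Algebraic Geometry* (1977), II Example 3.2.6 [Hartshorne1977]; H. Matsumura, *Commutative
Ring Theory* (1986), §32 (J-2 / regular locus open) [Matsumura1987]; The Stacks Project, Tags 01J3, 005X (Jacobson spaces) [StacksProject].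
-/

set_option linter.dupNamespace false

noncomputable section

open CategoryTheory AlgebraicGeometry TopologicalSpace Topology
open AlgebraicGeometry.Scheme.IdealSheafData

universe u

namespace Summit.ResolutionOfSingularities.ResolutionOfSingularities.Cruxes.EquisingularLiftNat.Sections.ND

/-! ## §1 Closed immersions from reduced schemes: `H ≅ (𝓘(closure (range ι))).subscheme` -/

section Reduced

variable {H P : Scheme.{u}} (ι : H ⟶ P) [IsClosedImmersion ι] [IsReduced H]

omit [IsReduced H] in
/-- The range of a closed immersion is closed, so its closure is itself. [folklore] -/
theorem closure_range_eq_range : closure (Set.range ι) = Set.range ι :=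
  ι.isClosedEmbedding.isClosed_range.closure_eq

/-- **`𝓘(closure (range ι)) = ker ι`** for a closed immersion `ι` from a reduced scheme (reduced induced structure).
[cite: Hartshorne1977, II Example 3.2.6] -/
theorem vanishingIdeal_closure_range_eq_ker :
    vanishingIdeal (⟨closure (Set.range ι), isClosed_closure⟩ : Closeds P) = ι.ker := by
  rw [Literature.AlgebraicGeometry.Motives.ker_eq_vanishingIdeal_of_isReduced ι]
  congr 1
  ext1
  exact closure_range_eq_range ι

omit [IsReduced H] in
/-- The reduced closed subscheme on `closure (range ι)` has the same underlying set as `ι`. [folklore] -/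
theorem range_subschemeι_vanishingIdeal_closure_range :
    Set.range (vanishingIdeal (⟨closure (Set.range ι), isClosed_closure⟩ : Closeds P)).subschemeι = Set.range ι := by
  rw [Literature.AlgebraicGeometry.Resolution.ComponentGluing.range_subschemeι_vanishingIdeal]
  exact closure_range_eq_range ι

/-- **`H ≅ T̂` over `P`**: a closed immersion `ι : H ⟶ P` from a reduced scheme factors through an ISOMORPHISM onto the reduced closed
subscheme `T̂` of `P` on `closure (range ι)` (uniqueness of the reduced closed-subscheme structure).
[cite: Hartshorne1977, II Example 3.2.6] -/
theorem exists_iso_subscheme_vanishingIdeal_closure_range :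
    ∃ e : H ≅ (vanishingIdeal (⟨closure (Set.range ι), isClosed_closure⟩ : Closeds P)).subscheme,
      e.hom ≫ (vanishingIdeal (⟨closure (Set.range ι), isClosed_closure⟩ : Closeds P)).subschemeι = ι := by
  haveI : IsReduced (vanishingIdeal (⟨closure (Set.range ι), isClosed_closure⟩ : Closeds P)).subscheme :=
    Literature.AlgebraicGeometry.Resolution.ComponentGluing.isReduced_subscheme_vanishingIdeal _
  exact Literature.AlgebraicGeometry.Motives.exists_iso_of_isClosedImmersion_of_range_eq _ ι
    (range_subschemeι_vanishingIdeal_closure_range ι)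

end Reduced

/-! ## §2 Transport of stalk regularity along an isomorphism over the ambient scheme -/

section Transport

variable {H T P : Scheme.{u}}

/-- Stalk regularity is invariant under an isomorphism of schemes: `𝒪_{T, e x} regular ↔ 𝒪_{H, x} regular`. [folklore] -/
theorem isRegularLocalRing_stalk_iff_of_iso (e : H ≅ T) (x : H) :
    IsRegularLocalRing (T.presheaf.stalk (e.hom x)) ↔ IsRegularLocalRing (H.presheaf.stalk x) := by
  constructor
  · intro h
    exact IsRegularLocalRing.of_ringEquiv (asIso (e.hom.stalkMap x)).commRingCatIsoToRingEquiv
  · intro h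
    have hx : e.inv (e.hom x) = x := Scheme.hom_inv_apply e x
    have h' : IsRegularLocalRing (H.presheaf.stalk (e.inv (e.hom x))) := by rwa [hx]
    exact IsRegularLocalRing.of_ringEquiv (asIso (e.inv.stalkMap (e.hom x))).commRingCatIsoToRingEquiv

/-- The same, read at a point of the target: `𝒪_{T, z} regular ↔ 𝒪_{H, e⁻¹ z} regular`. [folklore] -/
theorem isRegularLocalRing_stalk_iff_of_iso' (e : H ≅ T) (z : T) :
    IsRegularLocalRing (T.presheaf.stalk z) ↔ IsRegularLocalRing (H.presheaf.stalk (e.inv z)) := by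
  have hz : e.hom (e.inv z) = z := Scheme.inv_hom_apply e z
  conv_lhs => rw [← hz]
  exact isRegularLocalRing_stalk_iff_of_iso e (e.inv z)

/-- Along `e : H ≅ T` over `P` (`e.hom ≫ j = ι`), the point `e⁻¹ z` of `H` lies over `j z`. [folklore] -/
theorem apply_inv_eq_of_iso_over (e : H ≅ T) {ι : H ⟶ P} {j : T ⟶ P} (he : e.hom ≫ j = ι) (z : T) :
    ι (e.inv z) = j z := by
  rw [← he, Scheme.Hom.comp_apply, Scheme.inv_hom_apply]

end Transport

/-! ## §3 Closed points: non-regular points are closed when the non-regular locus is finite -/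

section ClosedPoints

/-- **Non-regular points are closed** when the non-regular locus is finite, on a scheme locally of finite type over a perfect field
(the regular locus is open — tree `isOpen_regularLocus_of_locallyOfFiniteType_perfectField` — and the scheme is Jacobson).
[cite: Matsumura1987, §32 p. 260] -/
theorem isClosed_singleton_of_not_isRegularLocalRing {k : Type u} [Field k] [PerfectField k] {H : Scheme.{u}}
    (f : H ⟶ Spec (.of k)) [LocallyOfFiniteType f]
    (hfin : Set.Finite {x : H | ¬ IsRegularLocalRing (H.presheaf.stalk x)})
    {x : H} (hx : ¬ IsRegularLocalRing (H.presheaf.stalk x)) : IsClosed ({x} : Set H) := by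
  haveI : JacobsonSpace H := LocallyOfFiniteType.jacobsonSpace f
  have hopen := Literature.AlgebraicGeometry.Resolution.isOpen_regularLocus_of_locallyOfFiniteType_perfectField f
  have hclosed : IsClosed {x : H | ¬ IsRegularLocalRing (H.presheaf.stalk x)} := by
    have : {x : H | ¬ IsRegularLocalRing (H.presheaf.stalk x)} =
        (Literature.AlgebraicGeometry.Resolution.Scheme.regularLocus H)ᶜ := by
      ext y; rfl
    rw [this]
    exact hopen.isClosed_compl
  exact Summit.ResolutionOfSingularities.ResolutionOfSingularities.Theorems.SigmaMaxModificationsCorridor3.IsoTailsHS.isClosed_singleton_of_mem_finite_closed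
    hclosed hfin hx

/-- The image of a closed point under a closed immersion is a closed point. [folklore] -/
theorem isClosed_singleton_apply_of_isClosedImmersion {H P : Scheme.{u}} (ι : H ⟶ P) [IsClosedImmersion ι] {x : H}
    (hx : IsClosed ({x} : Set H)) : IsClosed ({ι x} : Set P) := by
  rw [← Set.image_singleton]
  exact ι.isClosedEmbedding.isClosedMap _ hx

end ClosedPoints

/-! ## §4 The `S`-block of `ND.NDInv` at the initial stage `(ℙⁿ_k, 𝟙, range ι)` -/

section SBlock

variable {H P : Scheme.{u}} (ι : H ⟶ P) [IsClosedImmersion ι] [IsReduced H]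

/-- **The finite non-regular set, read on `T̂`** (any ambient `P`): from `hfin` on `H`, a `Finset` `S ⊆ P` such that a point `z` of the
reduced closed subscheme `T̂` on `closure (range ι)` is regular iff `T̂.ι z ∉ S`, and every `x ∈ S` is `T̂.ι z` for some `z` and `ι x₀`
for some NON-REGULAR `x₀ : H`. [folklore] -/
theorem exists_finset_nonregular
    (hfin : Set.Finite {x : H | ¬ IsRegularLocalRing (H.presheaf.stalk x)}) :
    ∃ S : Finset P,
      (∀ z : ↥(vanishingIdeal (⟨closure (Set.range ι), isClosed_closure⟩ : Closeds P)).subscheme,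
        IsRegularLocalRing ((vanishingIdeal (⟨closure (Set.range ι), isClosed_closure⟩ : Closeds P)).subscheme.presheaf.stalk z) ↔
          ((vanishingIdeal (⟨closure (Set.range ι), isClosed_closure⟩ : Closeds P)).subschemeι z : P) ∉ S) ∧
      (∀ x ∈ S,
        (∃ z : ↥(vanishingIdeal (⟨closure (Set.range ι), isClosed_closure⟩ : Closeds P)).subscheme,
          ((vanishingIdeal (⟨closure (Set.range ι), isClosed_closure⟩ : Closeds P)).subschemeι z : P) = x) ∧
        ∃ x₀ : H, ι x₀ = x ∧ ¬ IsRegularLocalRing (H.presheaf.stalk x₀)) := by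
  classical
  obtain ⟨e, he⟩ := exists_iso_subscheme_vanishingIdeal_closure_range ι
  refine ⟨hfin.toFinset.image (fun x => ι x), fun z => ?_, fun x hx => ?_⟩
  · rw [isRegularLocalRing_stalk_iff_of_iso' e z, ← apply_inv_eq_of_iso_over e he z]
    constructor
    · intro hreg hmem
      obtain ⟨x₀, hx₀, hx₀z⟩ := Finset.mem_image.mp hmem
      have : x₀ = e.inv z := ι.isClosedEmbedding.injective hx₀z
      rw [Set.Finite.mem_toFinset] at hx₀
      exact hx₀ (this ▸ hreg)
    · intro hnot
      by_contra hreg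
      exact hnot (Finset.mem_image.mpr ⟨e.inv z, (Set.Finite.mem_toFinset _).mpr hreg, rfl⟩)
  · obtain ⟨x₀, hx₀, rfl⟩ := Finset.mem_image.mp hx
    rw [Set.Finite.mem_toFinset] at hx₀
    refine ⟨⟨e.hom x₀, ?_⟩, x₀, rfl, hx₀⟩
    rw [← Scheme.Hom.comp_apply, he]

/-- **THE `S`-BLOCK OF `ND.NDInv` AT THE INITIAL STAGE** `(ℙⁿ_k, 𝟙, range ι)`: `ι : H ⟶ ℙⁿ_k` a closed immersion, `H` reduced,
`k` algebraically closed, non-regular locus of `H` finite ⇒ a `Finset` `S` of `ℙⁿ_k` with the exact regularity bookkeeping of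
`ND.NDInv` on the reduced closed subscheme `T̂` of `ℙⁿ_k` on `closure (range ι)`, every member of `S` a CLOSED point in the range of
`T̂.ι` and the image of a non-regular point of `H`.  (B4γ)'s remaining content is the local ND frame at each `x ∈ S`.
[OURS · L1 W4.5b · (B4γ) support] -/
theorem exists_finset_nonregular_range {k : Type u} [Field k] [IsAlgClosed k] {n : ℕ} {H : Scheme.{u}}
    (ι : H ⟶ (Literature.AlgebraicGeometry.Motives.projectiveSpace n k).left) [IsClosedImmersion ι] [IsReduced H]
    (hfin : Set.Finite {x : H | ¬ IsRegularLocalRing (H.presheaf.stalk x)}) :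
    ∃ S : Finset (Literature.AlgebraicGeometry.Motives.projectiveSpace n k).left,
      (∀ z : ↥(vanishingIdeal (⟨closure (Set.range ι), isClosed_closure⟩ :
          Closeds (Literature.AlgebraicGeometry.Motives.projectiveSpace n k).left)).subscheme,
        IsRegularLocalRing ((vanishingIdeal (⟨closure (Set.range ι), isClosed_closure⟩ :
          Closeds (Literature.AlgebraicGeometry.Motives.projectiveSpace n k).left)).subscheme.presheaf.stalk z) ↔
          ((vanishingIdeal (⟨closure (Set.range ι), isClosed_closure⟩ :
            Closeds (Literature.AlgebraicGeometry.Motives.projectiveSpace n k).left)).subschemeι z :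
              (Literature.AlgebraicGeometry.Motives.projectiveSpace n k).left) ∉ S) ∧
      (∀ x ∈ S,
        (∃ z : ↥(vanishingIdeal (⟨closure (Set.range ι), isClosed_closure⟩ :
            Closeds (Literature.AlgebraicGeometry.Motives.projectiveSpace n k).left)).subscheme,
          ((vanishingIdeal (⟨closure (Set.range ι), isClosed_closure⟩ :
            Closeds (Literature.AlgebraicGeometry.Motives.projectiveSpace n k).left)).subschemeι z :
              (Literature.AlgebraicGeometry.Motives.projectiveSpace n k).left) = x) ∧
        IsClosed ({x} : Set (Literature.AlgebraicGeometry.Motives.projectiveSpace n k).left) ∧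
        ∃ x₀ : H, ι x₀ = x ∧ ¬ IsRegularLocalRing (H.presheaf.stalk x₀)) := by
  haveI := Literature.AlgebraicGeometry.Motives.isProper_projectiveSpace n k
  haveI : LocallyOfFiniteType (ι ≫ (Literature.AlgebraicGeometry.Motives.projectiveSpace n k).hom) := inferInstance
  obtain ⟨S, hS, hS'⟩ := exists_finset_nonregular ι hfin
  refine ⟨S, hS, fun x hx => ?_⟩
  obtain ⟨hz, x₀, hx₀, hnreg⟩ := hS' x hx
  refine ⟨hz, ?_, x₀, hx₀, hnreg⟩
  rw [← hx₀]
  exact isClosed_singleton_apply_of_isClosedImmersion ι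
    (isClosed_singleton_of_not_isRegularLocalRing (ι ≫ (Literature.AlgebraicGeometry.Motives.projectiveSpace n k).hom) hfin hnreg)

end SBlock

end Summit.ResolutionOfSingularities.ResolutionOfSingularities.Cruxes.EquisingularLiftNat.Sections.ND

end
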